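import Summits.PneNP.PneNP.Theorems.SignDeg2Signing
import Summits.PneNP.PneNP.Theorems.LtfLocalAvoidFPMachine
import Summits.PneNP.PneNP.Theorems.Nc03AvoidResidualCoreReductionRankKit

/-!
# ROUND-18 item K3 `AffineSplit k` — part 1/3: the affine-split machine and its semantics on genuine codes

Cell pnp-ideate, rung after F-N1b (route packet `SignDeg2Avoid`, item K3 of pnp-ideate-p3's ROUND-17 §2 /
ROUND-18; `Summit.PneNP.PneNP.Theorems.SignDeg2Signing.AffineSplit k :=
SignDeg2OnlyAvoidLinearFP k → SignDeg2AvoidLinearFP k`).  THE AFFINE SPLIT: an FP range-avoider for the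
`k`-local maps all of whose tables have sign-degree `≤ 2` yields one for the maps each of whose tables has
sign-degree `≤ 2` OR is AFFINE (`IsAffinePred`: `±χ_S`, i.e. a parity of some of the read bits, possibly
negated).  The solver is ONE string function `affStr k f₀` (this file: its definition as a program on lists,
and what it computes on the code of an instance; part 2: correctness; part 3: `CodeFP` typing and the theorem):

* decode the instance (`LocalMapDecodeFP.decode`, every `k`), classify every output by the FINITE table
  `affRow k` (affine? ; its `𝔽₂`-row `Σ_{i ∈ S} e_{v_{j,i}}` as an index list; its constant bit `P(0…0)`);
* if at least `n + 1` outputs are affine: their rows are dependent — the FIRST affine row lying in the span of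
  the earlier affine rows is found with the tree's span test `Nc03Reduction.inSpan` (Gaussian elimination over
  `𝔽₂`, `…ReductionRankKit`), and the answer is the vector of constant bits with THAT bit flipped (`outA`);
* otherwise the `≥ m − n` non-affine outputs (all of sign-degree `≤ 2`) are re-encoded as a sub-instance on the
  same inputs (`subCode`), the hypothesised solver `f₀` is run on it, and its answer is scattered back (`outB`).

Restricted-model algorithmic infrastructure (range avoidance for local maps); nothing here bears on `P` versus `NP`.
-/

set_option linter.dupNamespace false -- `Summit.PneNP.PneNP.…`: summit = sub-problem name (D-0017 single-conjunct layout)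

namespace Summit.PneNP.PneNP.Theorems.AffineSplitFP

open Literature.Computability.Complexity
open Summit.PneNP.PneNP.Theorems.SignDeg2Signing (IsAffinePred)
open Summit.PneNP.PneNP.Theorems.LtfLocalAvoidFP (allBits mem_allBits tableOfBits tableOfBits_tabOf)
open Summit.PneNP.PneNP.Theorems.MajLocalAvoidFP (rowOf length_rowOf getD_rowOf)
open Summit.PneNP.PneNP.Theorems.LocalMapDecodeFP (tabOf length_tabOf posCode blockOf encode_eq decode outsOf decode_encode
  hdrN hdrN_encode)
open Summit.PneNP.PneNP.Theorems.Nc03Reduction (inSpan)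

variable {k n m : ℕ}

/-! ## Affine data of a table (the machine constant) -/

open Classical in
/-- AFFINE DATA of a `k`-bit table `P`: `(affine?, (support positions, constant bit))` — for an affine `P`
(`IsAffinePred P`, i.e. `bsgn ∘ P = ±χ_S`) the flag `true`, SOME support `S` (listed, as naturals `< k`) and
the constant bit `P (0…0)`; for a non-affine `P` the flag `false`.  (A noncomputable CHOICE; for fixed `k` a
finite table, hard-coded in the machine.) -/
noncomputable def affData (P : (Fin k → Bool) → Bool) : Bool × (List ℕ × Bool) :=
  if h : IsAffinePred P then (true, ((Classical.choose h).toList.map Fin.val, P fun _ => false))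
  else (false, ([], false))

/-- The chosen support of an affine table. -/
noncomputable def affSupp (P : (Fin k → Bool) → Bool) (h : IsAffinePred P) : Finset (Fin k) := Classical.choose h

/-- The chosen support satisfies the defining dichotomy `bsgn ∘ P = ±χ_S`. -/
theorem affSupp_spec (P : (Fin k → Bool) → Bool) (h : IsAffinePred P) :
    (∀ u, bsgn (P u) = chiQ (affSupp P h) u) ∨ (∀ u, bsgn (P u) = -chiQ (affSupp P h) u) :=
  Classical.choose_spec h

/-- Affine data of an affine table. -/
theorem affData_of_aff (P : (Fin k → Bool) → Bool) (h : IsAffinePred P) :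
    affData P = (true, ((affSupp P h).toList.map Fin.val, P fun _ => false)) := by
  unfold affData affSupp; rw [dif_pos h]

/-- Affine data of a non-affine table. -/
theorem affData_of_not_aff (P : (Fin k → Bool) → Bool) (h : ¬ IsAffinePred P) : affData P = (false, ([], false)) := by
  unfold affData; rw [dif_neg h]

/-- The flag is `true` exactly for affine tables. -/
theorem affData_fst (P : (Fin k → Bool) → Bool) : (affData P).1 = true ↔ IsAffinePred P := by
  by_cases h : IsAffinePred P
  · rw [affData_of_aff P h]; simp [h]
  · rw [affData_of_not_aff P h]; simp [h]

/-- The affine data READ OFF A TABLE BLOCK (junk blocks of the wrong length ↦ non-affine, so that this is a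
FINITE lookup for the typing). -/
noncomputable def affRow (k : ℕ) (tab : List Bool) : Bool × (List ℕ × Bool) :=
  if tab ∈ allBits (2 ^ k) then affData (tableOfBits k tab) else (false, ([], false))

/-- On the table block of output `j` the lookup returns the affine data of its table. -/
theorem affRow_tabOf (I : LocalMap k n m) (j : Fin m) : affRow k (tabOf I j) = affData (I.table j) := by
  unfold affRow
  rw [if_pos (mem_allBits.2 (length_tabOf I j)), tableOfBits_tabOf]

/-! ## The program -/

/-- A classified output: `(output index, (affine?, (𝔽₂-row as an index list, constant bit)))`. -/
abbrev Rec : Type := ℕ × (Bool × (List ℕ × Bool))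

/-- Classifying one decoded output `(table bits, positions)`: the support positions are replaced by the
positions READ there, giving the row `Σ_{i ∈ S} e_{v_i}` as an index list. -/
noncomputable def cls (k : ℕ) (o : List Bool × List ℕ) : Bool × (List ℕ × Bool) :=
  ((affRow k o.1).1, ((affRow k o.1).2.1.map fun i => o.2.getD i 0, (affRow k o.1).2.2))

/-- All outputs, classified and indexed. -/
noncomputable def recs (k : ℕ) (outs : List (List Bool × List ℕ)) : List Rec := outs.mapIdx fun j o => (j, cls k o)

/-- The affine outputs. -/
def affRecs (rs : List Rec) : List Rec := rs.filter fun r => r.2.1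

/-- The indices of the non-affine outputs. -/
def nonIdx (rs : List Rec) : List ℕ := (rs.filter fun r => !r.2.1).map Prod.fst

/-- The rows of a list of classified outputs. -/
def rowsOf (rs : List Rec) : List (List ℕ) := rs.map fun r => r.2.2.1

/-- The FIRST row lying in the `𝔽₂`-span of the earlier rows (by the span test `inSpan`; `= |rows|` if none). -/
def tStar (N : ℕ) (rows : List (List ℕ)) : ℕ :=
  (List.range rows.length).findIdx fun t => inSpan N (rows.take t) (rows.getD t [])

/-- The output index of the first dependent affine row. -/
def jStar (N : ℕ) (ars : List Rec) : ℕ := (ars.map Prod.fst).getD (tStar N (rowsOf ars)) 0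

/-- BRANCH A (many affine outputs): the constant bits, the bit of the first dependent affine row FLIPPED,
`false` on the non-affine outputs. -/
def outA (N : ℕ) (rs : List Rec) : List Bool :=
  rs.map fun r => r.2.1 && (r.2.2.2 ^^ (r.1 == jStar N (affRecs rs)))

/-- The code block of a decoded output, rebuilt (positions capped at `N`; genuine positions are `< N`). -/
def blk (N : ℕ) (o : List Bool × List ℕ) : List Bool :=
  o.1 ++ (o.2.map fun v => LocalMap.unaryCode (min v N)).flatten

/-- The non-affine outputs (decoded). -/
noncomputable def subOuts (k : ℕ) (outs : List (List Bool × List ℕ)) : List (List Bool × List ℕ) :=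
  outs.filter fun o => !(affRow k o.1).1

/-- The input code of the SUB-INSTANCE of the non-affine outputs on the same `N` inputs. -/
noncomputable def subCode (k N : ℕ) (outs : List (List Bool × List ℕ)) : List Bool :=
  LocalMap.unaryCode N ++ LocalMap.unaryCode (subOuts k outs).length ++ ((subOuts k outs).map (blk N)).flatten

/-- BRANCH B (few affine outputs): the hypothesised solver's answer on the sub-instance, scattered back to
the non-affine outputs (bit number `rank of j among the non-affine outputs`), `false` on the affine ones. -/
noncomputable def outB (k : ℕ) (f₀ : List Bool → List Bool) (N : ℕ) (outs : List (List Bool × List ℕ)) : List Bool :=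
  (recs k outs).map fun r => !r.2.1 && (f₀ (subCode k N outs)).getD ((nonIdx (recs k outs)).findIdx (· == r.1)) false

/-- The solver on decoded data: branch A iff at least `N + 1` outputs are affine. -/
noncomputable def solve (k : ℕ) (f₀ : List Bool → List Bool) (N : ℕ) (outs : List (List Bool × List ℕ)) : List Bool :=
  if N + 1 ≤ (affRecs (recs k outs)).length then outA N (recs k outs) else outB k f₀ N outs

/-- **THE MACHINE** `affStr k f₀`: decode, classify, branch. -/
noncomputable def affStr (k : ℕ) (f₀ : List Bool → List Bool) (w : List Bool) : List Bool :=
  solve k f₀ (hdrN w) (decode k w)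

/-! ## Semantics on the code of an instance -/

/-- Output `j` is affine (Boolean flag). -/
noncomputable def aff (I : LocalMap k n m) (j : Fin m) : Bool := (affData (I.table j)).1

/-- The `𝔽₂`-row of output `j` as an index list: the positions read at the chosen support. -/
noncomputable def rowL (I : LocalMap k n m) (j : Fin m) : List ℕ :=
  (affData (I.table j)).2.1.map fun i => (rowOf I j).getD i 0

/-- The constant bit of output `j`. -/
noncomputable def cbit (I : LocalMap k n m) (j : Fin m) : Bool := (affData (I.table j)).2.2

/-- The classified record of output `j`. -/
noncomputable def recOf (I : LocalMap k n m) (j : Fin m) : Rec := (j.val, (aff I j, (rowL I j, cbit I j)))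

/-- The affine outputs, in increasing order. -/
noncomputable def affList (I : LocalMap k n m) : List (Fin m) := (List.finRange m).filter fun j => aff I j

/-- The non-affine outputs, in increasing order. -/
noncomputable def nonList (I : LocalMap k n m) : List (Fin m) := (List.finRange m).filter fun j => !aff I j

/-- `aff` says `IsAffinePred`. -/
theorem aff_iff (I : LocalMap k n m) (j : Fin m) : aff I j = true ↔ IsAffinePred (I.table j) := affData_fst _

/-- Classifying the decoded output `j`. -/
theorem cls_out (I : LocalMap k n m) (j : Fin m) : cls k (tabOf I j, rowOf I j) = (aff I j, (rowL I j, cbit I j)) := by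
  unfold cls aff rowL cbit; rw [affRow_tabOf]

/-- `mapIdx` over a `finRange`-indexed list. -/
theorem mapIdx_map_finRange {α β : Type} (g : Fin m → α) (f : ℕ → α → β) :
    ((List.finRange m).map g).mapIdx f = (List.finRange m).map fun j => f j.val (g j) := by
  apply List.ext_getElem
  · simp
  · intro i h₁ h₂
    rw [List.getElem_mapIdx, List.getElem_map, List.getElem_map, List.getElem_finRange]
    rfl

/-- **The classified outputs of a genuine code.** -/
theorem recs_outsOf (I : LocalMap k n m) : recs k (outsOf I) = (List.finRange m).map (recOf I) := by
  unfold recs outsOf recOf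
  rw [mapIdx_map_finRange]
  refine List.map_congr_left fun j _ => ?_
  rw [cls_out]

/-- The affine records of a genuine code. -/
theorem affRecs_outsOf (I : LocalMap k n m) : affRecs (recs k (outsOf I)) = (affList I).map (recOf I) := by
  rw [recs_outsOf, affRecs, affList, List.filter_map]; rfl

/-- The number of affine records is the number of affine outputs. -/
theorem length_affRecs_outsOf (I : LocalMap k n m) : (affRecs (recs k (outsOf I))).length = (affList I).length := by
  rw [affRecs_outsOf, List.length_map]

/-- The non-affine indices of a genuine code. -/
theorem nonIdx_outsOf (I : LocalMap k n m) : nonIdx (recs k (outsOf I)) = (nonList I).map Fin.val := by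
  rw [recs_outsOf, nonIdx, nonList, List.filter_map, List.map_map]; rfl

/-- The affine rows of a genuine code. -/
theorem rowsOf_affRecs_outsOf (I : LocalMap k n m) : rowsOf (affRecs (recs k (outsOf I))) = (affList I).map (rowL I) := by
  rw [affRecs_outsOf, rowsOf, List.map_map]; rfl

/-- The affine indices of a genuine code. -/
theorem map_fst_affRecs_outsOf (I : LocalMap k n m) :
    (affRecs (recs k (outsOf I))).map Prod.fst = (affList I).map Fin.val := by
  rw [affRecs_outsOf, List.map_map]; rfl

/-- The non-affine decoded outputs of a genuine code. -/
theorem subOuts_outsOf (I : LocalMap k n m) :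
    subOuts k (outsOf I) = (nonList I).map fun j => (tabOf I j, rowOf I j) := by
  unfold subOuts outsOf nonList aff
  rw [List.filter_map]
  congr 1
  refine List.filter_congr fun j _ => ?_
  simp only [Function.comp_apply, affRow_tabOf]

/-- Rebuilding the block of a decoded genuine output gives its code block. -/
theorem blk_out (I : LocalMap k n m) (j : Fin m) : blk n (tabOf I j, rowOf I j) = blockOf I j := by
  unfold blk blockOf posCode
  congr 2
  refine List.map_congr_left fun v hv => ?_
  obtain ⟨i, rfl⟩ := (List.mem_ofFn' _ _).1 hv
  rw [min_eq_left (I.vars j i).isLt.le]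

/-- Reading the answer: bit `j` of a `finRange`-indexed list. -/
theorem getD_map_finRange {α : Type} (g : Fin m → α) (d : α) (j : Fin m) : ((List.finRange m).map g).getD j.val d = g j := by
  rw [List.getD_eq_getElem?_getD, List.getElem?_map, List.getElem?_eq_getElem (by simp), List.getElem_finRange]
  simp

/-- **What the machine prints on a genuine code, branch A** (`n + 1 ≤` number of affine outputs): at an
affine output its constant bit, flipped at the output `jStar`; `false` elsewhere. -/
theorem readOut_affStr_A (f₀ : List Bool → List Bool) (I : LocalMap k n m) (hA : n + 1 ≤ (affList I).length) (j : Fin m) :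
    readOut m (affStr k f₀ I.encode) j =
      (aff I j && (cbit I j ^^ (j.val == jStar n ((affList I).map (recOf I))))) := by
  unfold readOut affStr solve
  rw [decode_encode, hdrN_encode, length_affRecs_outsOf, if_pos hA, outA, affRecs_outsOf, recs_outsOf, List.map_map,
    getD_map_finRange]
  rfl

/-- **What the machine prints on a genuine code, branch B** (fewer than `n + 1` affine outputs): at a
non-affine output, bit `rank of j among the non-affine outputs` of `f₀` run on the sub-instance code;
`false` elsewhere. -/
theorem readOut_affStr_B (f₀ : List Bool → List Bool) (I : LocalMap k n m) (hB : ¬ n + 1 ≤ (affList I).length) (j : Fin m) :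
    readOut m (affStr k f₀ I.encode) j =
      (!aff I j && (f₀ (subCode k n (outsOf I))).getD (((nonList I).map Fin.val).findIdx (· == j.val)) false) := by
  unfold readOut affStr solve
  rw [decode_encode, hdrN_encode, length_affRecs_outsOf, if_neg hB, outB, nonIdx_outsOf, recs_outsOf, List.map_map,
    getD_map_finRange]
  rfl

end Summit.PneNP.PneNP.Theorems.AffineSplitFP
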